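import Summits.Ventures.PercRepro.Night2FatXIndepLine
import Summits.Ventures.PercRepro.Night2FatXDistOne

/-!
# night-2: the level bounds of the independent-count criterion

The criterion of record `basis_pair_fair_of_fat_indep_sum` sums `capS T / ((221/360) · 2 · I₄(P_T))` over the unloaded
targets `T ∋ x`, `P_T = (T ∖ K) ∖ {w₀, x}`.  `I₄(P_T) ≥ 1` (the basis points off `w₀` are an independent four-subset,
`one_le_indep_count`), so a uniform bound `I₄ ≤ I` over the targets above `Q ∪ X` at level `j` gives the level bound
`C(N − |X|, j − |X|) · c_j / ((221/360) · 2 · I)` (**`fat_indep_level_ge_of_bound`**), `c_j = 1` at the top four levels and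
`11/18` otherwise; `I = C(j + 3, 4)` always works (`indep_count_le_choose`).  `sum_levels_le_sum` restricts a sum to a
set of levels.  Paper `proofs/NIGHT-2-g33.md` §5.
-/

namespace PercRepro.Shadow

open PercRepro.ThmH PercRepro.PerFlat

variable {α : Type*} [DecidableEq α] {M : Matroid α} [M.Finite] {G : Finset α}

omit [DecidableEq α] in
/-- A sum over a family dominates the sum of its fibres over any set of levels (nonnegative terms). -/
theorem sum_levels_le_sum {F : Finset (Finset α)} {f : Finset α → ℚ} (hf : ∀ T ∈ F, 0 ≤ f T)
    (lev : Finset α → ℕ) (J : Finset ℕ) :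
    (∑ j ∈ J, ∑ T ∈ F.filter (fun T => lev T = j), f T) ≤ ∑ T ∈ F, f T := by
  have hfib := Finset.sum_fiberwise_of_maps_to (s := F.filter (fun T => lev T ∈ J)) (t := J)
    (g := lev) (f := f) (fun T hT => (Finset.mem_filter.1 hT).2)
  have hinner : ∀ j ∈ J, (F.filter (fun T => lev T ∈ J)).filter (fun T => lev T = j) =
      F.filter (fun T => lev T = j) := by
    intro j hj
    ext T
    simp only [Finset.mem_filter]
    constructor
    · rintro ⟨⟨h1, -⟩, h2⟩
      exact ⟨h1, h2⟩
    · rintro ⟨h1, h2⟩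
      exact ⟨⟨h1, h2 ▸ hj⟩, h2⟩
  calc ∑ j ∈ J, ∑ T ∈ F.filter (fun T => lev T = j), f T
      = ∑ j ∈ J, ∑ T ∈ (F.filter (fun T => lev T ∈ J)).filter (fun T => lev T = j), f T := by
        apply Finset.sum_congr rfl
        intro j hj
        rw [hinner j hj]
    _ = ∑ T ∈ F.filter (fun T => lev T ∈ J), f T := hfib
    _ ≤ ∑ T ∈ F, f T := by
        apply Finset.sum_le_sum_of_subset_of_nonneg (Finset.filter_subset _ _)
        intro T hT _
        exact hf T hT

open scoped Classical in
/-- **`I₄(P_T) ≥ 1`**: the four basis points off `w₀` form an independent four-subset of `P_T`. -/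
theorem one_le_indep_count (hG : G ∈ flatsQ M (5 + 1)) (hd : (gr M \ G).card = 2) (hk : kColoops M G = 1)
    {B : Finset α} (hB : B ∈ thinMembers M 5 G) (hnP : ¬ bigP M G B) {z : α} (hz : z ∈ G \ clF M B)
    {T : Finset α} (hT : T ∈ tgtSets M 5 G B z) {w₀ x : α} (hw₀ : w₀ ∈ insert z B \ coloops M G)
    (hx : x ∉ insert z B) :
    1 ≤ ((((T \ coloops M G) \ {w₀, x}).powersetCard 4).filter
      (fun F : Finset α => M.Indep (↑F : Set α))).card := by
  have hQT : insert z B ⊆ T := (mem_tgtSets.1 hT).2.1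
  have hQ5 := card_insert_sdiff_eq_five hG hd hk hB hnP hz
  have hrk5 := rkN_insert_sdiff_coloops_eq_five_of_thin hG hd hk hB hz
  have hind : M.Indep ((insert z B \ coloops M G : Finset α) : Set α) :=
    indep_of_rkN_eq_card (by rw [hrk5, hQ5])
  set P₀ := (insert z B \ coloops M G).erase w₀ with hP₀
  have hP₀sub : P₀ ⊆ (T \ coloops M G) \ {w₀, x} := by
    intro e he
    rw [hP₀, Finset.mem_erase, Finset.mem_sdiff] at he
    rw [Finset.mem_sdiff, Finset.mem_sdiff, Finset.mem_insert, Finset.mem_singleton]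
    refine ⟨⟨hQT he.2.1, he.2.2⟩, ?_⟩
    rintro (h' | h')
    · exact he.1 h'
    · exact hx (h' ▸ he.2.1)
  have hP₀card : P₀.card = 4 := by
    rw [hP₀, Finset.card_erase_of_mem hw₀, hQ5]
  have hP₀ind : M.Indep ((P₀ : Finset α) : Set α) := hind.subset (by
    rw [hP₀]
    exact_mod_cast Finset.erase_subset _ _)
  exact Finset.card_pos.2 ⟨P₀, Finset.mem_filter.2 ⟨Finset.mem_powersetCard.2 ⟨hP₀sub, hP₀card⟩, hP₀ind⟩⟩

open scoped Classical in
/-- `I₄(P_T) ≤ C(|T ∖ Q| + 3, 4)`. -/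
theorem indep_count_le_choose (hG : G ∈ flatsQ M (5 + 1)) (hd : (gr M \ G).card = 2) (hk : kColoops M G = 1)
    {B₀ : Finset α} (hB₀ : B₀ ∈ thinMembers M 5 G) {w₀ x : α} (hD : G \ clF M B₀ = {w₀, x}) (hne : w₀ ≠ x)
    {B : Finset α} (hB : B ∈ thinMembers M 5 G) (hnP : ¬ bigP M G B) {z : α} (hz : z ∈ G \ clF M B)
    {T : Finset α} (hT : T ∈ tgtSets M 5 G B z) (hw₀T : w₀ ∈ T) (hxT : x ∈ T) :
    ((((T \ coloops M G) \ {w₀, x}).powersetCard 4).filter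
      (fun F : Finset α => M.Indep (↑F : Set α))).card ≤ ((T \ insert z B).card + 3).choose 4 := by
  have hP := card_sdiff_off_eq_level_add_three hG hd hk hB₀ hD hne hB hnP hz hT hw₀T hxT
  have hP' : ((T \ coloops M G) \ {w₀, x}).card = (T \ insert z B).card + 3 := by omega
  calc _ ≤ (((T \ coloops M G) \ {w₀, x}).powersetCard 4).card := Finset.card_filter_le _ _
    _ = _ := by rw [Finset.card_powersetCard, hP']

open scoped Classical in
/-- **The level bound of the independent-count criterion**: if every target above `Q ∪ X` (`x ∈ X`) at level `j` is
unloaded with `I₄(P_T) ≤ I`, the level-`j` sum is at least `C(N − |X|, j − |X|) · c_j / ((221/360) · 2 · I)`. -/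
theorem fat_indep_level_ge_of_bound (hG : G ∈ flatsQ M (5 + 1)) (hd : (gr M \ G).card = 2)
    (hk : kColoops M G = 1) {B : Finset α} (hB : B ∈ thinMembers M 5 G) (hnP : ¬ bigP M G B) {z : α}
    (hz : z ∈ G \ clF M B) {w₀ x : α} (hw₀ : w₀ ∈ insert z B \ coloops M G) (hx : x ∉ insert z B)
    {X : Finset α} (hX : X ⊆ G \ insert z B) (hxX : x ∈ X) {j : ℕ} (hj : 1 ≤ j) (hjX : X.card ≤ j)
    {I : ℕ} (hI : 0 < I)
    (hload : ∀ T ∈ tgtSets M 5 G B z, X ⊆ T → (T \ insert z B).card = j →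
      dload M 5 G (bigP M G) (dshGT2 M 5 G) T = 0)
    (hbound : ∀ T ∈ tgtSets M 5 G B z, X ⊆ T → (T \ insert z B).card = j →
      ((((T \ coloops M G) \ {w₀, x}).powersetCard 4).filter
        (fun F : Finset α => M.Indep (↑F : Set α))).card ≤ I) :
    ((((G \ insert z B).card - X.card).choose (j - X.card) : ℕ) : ℚ) *
      ((if (G \ insert z B).card - j ≤ 3 then (1 : ℚ) else 11 / 18) / ((221 / 360 : ℚ) * ((2 * I : ℕ) : ℚ))) ≤
      ∑ T ∈ ((tgtSets M 5 G B z).filter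
        (fun T => x ∈ T ∧ dload M 5 G (bigP M G) (dshGT2 M 5 G) T = 0)).filter
        (fun T => (T \ insert z B).card = j),
        capS M 5 G T / ((221 / 360 : ℚ) *
          ((2 * ((((T \ coloops M G) \ {w₀, x}).powersetCard 4).filter
            (fun F : Finset α => M.Indep (↑F : Set α))).card : ℕ) : ℚ)) := by
  have hcount := choose_le_card_targets_level hG hB hz hX hj hjX
  set F := ((tgtSets M 5 G B z).filter
    (fun T => x ∈ T ∧ dload M 5 G (bigP M G) (dshGT2 M 5 G) T = 0)).filter
    (fun T => (T \ insert z B).card = j) with hF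
  set c : ℚ := if (G \ insert z B).card - j ≤ 3 then 1 else 11 / 18 with hc
  set t : ℚ := c / ((221 / 360 : ℚ) * ((2 * I : ℕ) : ℚ)) with ht
  have hsub : (tgtSets M 5 G B z).filter (fun T => X ⊆ T ∧ (T \ insert z B).card = j) ⊆ F := by
    intro T hT
    rw [Finset.mem_filter] at hT
    rw [hF, Finset.mem_filter, Finset.mem_filter]
    exact ⟨⟨hT.1, hT.2.1 hxX, hload T hT.1 hT.2.1 hT.2.2⟩, hT.2.2⟩
  -- the sub-family above `Q ∪ X` carries the bound; the rest of `F` is nonnegative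
  have hsum : ∑ T ∈ (tgtSets M 5 G B z).filter (fun T => X ⊆ T ∧ (T \ insert z B).card = j),
      capS M 5 G T / ((221 / 360 : ℚ) *
        ((2 * ((((T \ coloops M G) \ {w₀, x}).powersetCard 4).filter
          (fun F : Finset α => M.Indep (↑F : Set α))).card : ℕ) : ℚ)) ≤
      ∑ T ∈ F, capS M 5 G T / ((221 / 360 : ℚ) *
        ((2 * ((((T \ coloops M G) \ {w₀, x}).powersetCard 4).filter
          (fun F : Finset α => M.Indep (↑F : Set α))).card : ℕ) : ℚ)) := by
    apply Finset.sum_le_sum_of_subset_of_nonneg hsub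
    intro T _ _
    have hd' : (gr M \ G).card ≤ 5 := by omega
    exact div_nonneg (capS_nonneg' hG hd' T) (by positivity)
  refine le_trans ?_ hsum
  have hterm : ∀ T ∈ (tgtSets M 5 G B z).filter (fun T => X ⊆ T ∧ (T \ insert z B).card = j), t ≤
      capS M 5 G T / ((221 / 360 : ℚ) *
        ((2 * ((((T \ coloops M G) \ {w₀, x}).powersetCard 4).filter
          (fun F : Finset α => M.Indep (↑F : Set α))).card : ℕ) : ℚ)) := by
    intro T hT
    rw [Finset.mem_filter] at hT
    obtain ⟨hTt, hXT, hTj⟩ := hT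
    have hTG : T ⊆ G := subset_G_of_mem_shadowAt (mem_tgtSets.1 hTt).1
    have hGT := card_sdiff_add_card_sdiff_of_mem_tgtSets hTt
    have hcap : c ≤ capS M 5 G T := by
      rw [hc]
      split_ifs with h3
      · rw [capS_eq_one_of_card_sdiff_le_three hd (by omega)]
      · exact capS_ge_eleven_eighteenths_two_one hd hk hTG
    have h1 := one_le_indep_count hG hd hk hB hnP hz hTt hw₀ hx
    have hb := hbound T hTt hXT hTj
    rw [ht]
    apply div_le_div₀ (le_trans (by rw [hc]; split_ifs <;> norm_num) hcap) hcap (by positivity)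
    apply mul_le_mul_of_nonneg_left _ (by norm_num)
    exact_mod_cast Nat.mul_le_mul_left 2 hb
  calc ((((G \ insert z B).card - X.card).choose (j - X.card) : ℕ) : ℚ) * t
      ≤ (((tgtSets M 5 G B z).filter (fun T => X ⊆ T ∧ (T \ insert z B).card = j)).card : ℚ) * t := by
        apply mul_le_mul_of_nonneg_right (by exact_mod_cast hcount)
        rw [ht, hc]
        split_ifs <;> positivity
    _ = ∑ _T ∈ (tgtSets M 5 G B z).filter (fun T => X ⊆ T ∧ (T \ insert z B).card = j), t := by
        rw [Finset.sum_const, nsmul_eq_mul]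
    _ ≤ _ := Finset.sum_le_sum hterm

end PercRepro.Shadow
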